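import Mathlib
import Summits.Ventures.PercRepro2.Defs
import Summits.Ventures.PercRepro2.Graph
import Summits.Ventures.PercRepro2.Harris
import Summits.Ventures.PercRepro2.Events
import Summits.Ventures.PercRepro2.Independence
import Summits.Ventures.PercRepro2.Induced
import Summits.Ventures.PercRepro2.Exploration
import Summits.Ventures.PercRepro2.GateDefs
import Summits.Ventures.PercRepro2.GateAnatomy
import Summits.Ventures.PercRepro2.GateForest
import Summits.Ventures.PercRepro2.GateLSM
import Summits.Ventures.PercRepro2.HullTree
import Summits.Ventures.PercRepro2.GateFeedbackForest
import Summits.Ventures.PercRepro2.GateFeedback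
import Summits.Ventures.PercRepro2.GateFeedbackExit
import Summits.Ventures.PercRepro2.GateContract
import Summits.Ventures.PercRepro2.GateShadow
import Summits.Ventures.PercRepro2.GateSide
import Summits.Ventures.PercRepro2.GateSep
import Summits.Ventures.PercRepro2.SideCluster
import Summits.Ventures.PercRepro2.CactusDefs
import Summits.Ventures.PercRepro2.CactusTriangle
import Summits.Ventures.PercRepro2.CactusTriangleMass
import Summits.Ventures.PercRepro2.CactusCluster
import Summits.Ventures.PercRepro2.CactusDel
import Summits.Ventures.PercRepro2.CactusChain
import Summits.Ventures.PercRepro2.CactusKappa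
import Summits.Ventures.PercRepro2.CactusGate
import Summits.Ventures.PercRepro2.GateSupport
import Summits.Ventures.PercRepro2.GateSupportSym
import Summits.Ventures.PercRepro2.CactusClosed

/-!
# The pendant region: a root's region hanging at ONE articulation vertex
(blind cell PercRepro2, mine-c g11; proofs/MINEC-FEEDBACK.md §9 Theorem 3, the single bounding
vertex, and §15.4)

If the root's region `C ∋ s` is closed at a single vertex `a` (every edge touching `C` has
its other end in `C ∪ {a}`), no `t–w` connection can use `C` (it would have to enter and leave
through `a`), so the hull-connection factor `κ(W) = P(t ↔ w in G ∖ W)` is CONSTANT on the clusters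
`W ⊆ C` (`connDelEvent_eq_of_subset_pendant`) and the κ-form of the support theorem needs only the
cluster law of `G[C]`: `G[C]` a triangular cactus built from the root ⟹ the free gate
(`gateRow_of_pendant_region`). This is Theorem 3 of the paper for a single bounding vertex, where
the hypothesis is on `G[C*]` alone.
-/

namespace Summit.Ventures.PercRepro2

namespace CactusGate

open Cactus CactusChain GateSide

open scoped Classical

variable {V : Type*} {E : Type*} [Fintype E] [Fintype V]
variable {R : Type*} [Field R] [LinearOrder R] [IsStrictOrderedRing R]
variable {ends : E → Sym2 V}

omit [Fintype E] in
/-- Deleting a subset `W` of a region closed at one vertex `a ∉ {t, w}` does not change the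
event `{t ↔ w}` (`t, w ∉ C`): `{t ↔ w in G ∖ W} = {t ↔ w}`. -/
lemma connDelEvent_eq_of_subset_pendant {C : Set V} {a t w : V} (htC : t ∉ C) (hwC : w ∉ C)
    (hC : ∀ e, ∀ x ∈ ends e, x ∈ C → ∀ y ∈ ends e, y ∈ C ∨ y = a) {W : Finset V}
    (hW : (↑W : Set V) ⊆ C) :
    connDelEvent ends W t w = connEvent ends t w := by
  apply Set.Subset.antisymm
  · exact connDelEvent_subset_connEvent ends W t w
  intro ω hω
  rw [mem_connDelEvent]
  have hc : Conn ends ω t w := hω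
  -- a `t–w` walk never needs `C`: follow it, and whenever it enters `C` through `a` it leaves
  -- through `a`; all the edges used outside `C` avoid `W ⊆ C`
  have key : w ∈ {v | (v ∉ C ∧ Conn ends (restrict (touches ends (↑W : Set V))ᶜ ω) t v) ∨
      (v ∈ C ∧ Conn ends (restrict (touches ends (↑W : Set V))ᶜ ω) t a)} := by
    refine mem_of_conn_of_closed (ends := ends) (ω := ω) ?_ (Or.inl ⟨htC, conn_refl _ _ _⟩) hc
    intro v hv v' hvv'
    obtain ⟨_, e, he, hends⟩ := openGraph_adj.1 hvv'
    have hedge : ∀ x y, x ∉ C → y ∉ C → ends e = s(x, y) →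
        (openGraph ends (restrict (touches ends (↑W : Set V))ᶜ ω)).Adj x y ∨ x = y := by
      intro x y hx hy hxy
      by_cases hxy' : x = y
      · exact Or.inr hxy'
      refine Or.inl (openGraph_adj.2 ⟨hxy', e, restrict_eq_true_iff.2 ⟨he, ?_⟩, hxy⟩)
      exact (Set.mem_compl_iff _ _).2 (notMem_touches_of_ends hxy (fun h => hx (hW h))
        (fun h => hy (hW h)))
    by_cases hv'C : v' ∈ C
    · -- entering `C` (or moving inside it): the entry is `a`
      rcases hv with ⟨hvC, hvt⟩ | ⟨hvC, hta⟩
      · have hva : v = a := by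
          rcases hC e v' (by rw [hends]; exact Sym2.mem_mk_right _ _) hv'C v
            (by rw [hends]; exact Sym2.mem_mk_left _ _) with h | h
          · exact (hvC h).elim
          · exact h
        exact Or.inr ⟨hv'C, hva ▸ hvt⟩
      · exact Or.inr ⟨hv'C, hta⟩
    · -- leaving `C` (or moving outside it): the exit is `a`
      rcases hv with ⟨hvC, hvt⟩ | ⟨hvC, hta⟩
      · rcases hedge v v' hvC hv'C hends with hadj | heq
        · exact Or.inl ⟨hv'C, hvt.trans hadj.reachable⟩
        · exact Or.inl ⟨hv'C, heq ▸ hvt⟩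
      · have hv'a : v' = a := by
          rcases hC e v (by rw [hends]; exact Sym2.mem_mk_left _ _) hvC v'
            (by rw [hends]; exact Sym2.mem_mk_right _ _) with h | h
          · exact (hv'C h).elim
          · exact h
        exact Or.inl ⟨hv'C, hv'a ▸ hta⟩
  rcases key with ⟨_, h⟩ | ⟨hwC', _⟩
  · exact h
  · exact (hwC hwC').elim

omit [Fintype E] in
/-- A cluster containing a vertex `a` that separates `t` from `w` has no `t–w` connection around
it: `{t ↔ w in G ∖ W} = ∅` for `a ∈ W`, `t ∉ W`. -/
lemma connDelEvent_eq_empty_of_sep {a t w : V} (hsep : t ∉ side ends a w) {W : Finset V}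
    (haW : a ∈ W) (htW : t ∉ W) : connDelEvent ends W t w = ∅ := by
  rw [Set.eq_empty_iff_forall_notMem]
  intro ω hω
  rw [mem_connDelEvent] at hω
  -- `w ↔ t` in `G ∖ W`, but `t` is not reachable from `w` in `G − a`: the connection passes `a`
  obtain ⟨z, hz, hc⟩ := GateShadow.exists_conn_mem_of_not_reachDel (T := {a}) (conn_symm hω) hsep
  rw [Finset.mem_singleton] at hz
  subst hz
  have hwW : w ∉ W := by
    intro hwW
    exact not_conn_restrict_of_mem htW hwW hω
  exact not_conn_restrict_of_mem hwW haW hc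

/-- **THE PENDANT REGION (FKG form).** The root's region `C ∋ s` closed at a single vertex
`a` separating `t` from `w` (`t, w ∉ C`), with `G[C]` a triangular cactus built from the root ⟹
the class-B mass of `(s, t, u, w)` is log-supermodular (the rest of `G` is arbitrary). -/
theorem massBLogSupermod_of_pendant_region {p : E → R} (hp : IsProbVec p) {s t u w : V}
    {C : Set V} {a : V} (hs : s ∈ C) (ha : a ∉ C) (htC : t ∉ C) (hwC : w ∉ C)
    (hsep : t ∉ side ends a w)
    (hC : ∀ e, ∀ x ∈ ends e, x ∈ C → ∀ y ∈ ends e, y ∈ C ∨ y = a)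
    (hF : IsCactusFrom ends s (within ends C)) :
    GateLSM.MassBLogSupermod p ends s t u w := by
  -- the region is closed between `a` and (vacuously) `t`
  have hC' : ∀ e, ∀ x ∈ ends e, x ∈ C → ∀ y ∈ ends e, y ∈ C ∨ y = a ∨ y = t := by
    intro e x hx hxC y hy
    rcases hC e x hx hxC y hy with h | h
    · exact Or.inl h
    · exact Or.inr (Or.inl h)
  -- clusters of nonzero class-B mass avoid `a` (else `κ = 0`) and hence lie in `C`
  have hsub : ∀ W : Finset V, GateLSM.massB p ends s t u w W ≠ 0 → (↑W : Set V) ⊆ C := by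
    intro W hz
    obtain ⟨ht', _, hw'⟩ := GateSupport.notMem_of_massB_ne_zero hz
    have haW : a ∉ W := by
      intro haW
      apply hz
      rw [GateSep.massB_eq_connDel, if_neg (by simp only [not_or]; exact ⟨ht', by assumption, hw'⟩),
        connDelEvent_eq_empty_of_sep hsep haW ht', prob_empty, mul_zero]
    have hz' : prob p (clusterEvent ends s (↑W : Set V) ∩ GateAnatomy.classB ends s t u w) ≠ 0 := hz
    obtain ⟨ω, hω, _⟩ := GateFeedback.nonempty_of_prob_ne_zero hz'
    have hω' : cluster ends ω s = ↑W := hω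
    rw [← hω']
    exact cluster_subset_of_closed hs hC' (by rw [hω']; exact fun h => haW (Finset.mem_coe.1 h))
      (by rw [hω']; exact fun h => ht' (Finset.mem_coe.1 h))
  refine GateSupport.massBLogSupermod_of_support_kappa hp ?_ ?_
  · -- (a) the cluster law through `G[C]`
    intro W₁ W₂ hz₁ hz₂
    have hW₁ := hsub W₁ hz₁
    have hW₂ := hsub W₂ hz₂
    have hWI : (↑(W₁ ∩ W₂) : Set V) ⊆ C := by
      rw [Finset.coe_inter]; exact Set.inter_subset_left.trans hW₁
    have hWU : (↑(W₁ ∪ W₂) : Set V) ⊆ C := by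
      rw [Finset.coe_union]; exact Set.union_subset hW₁ hW₂
    rw [prob_clusterEvent_eq_massOn_closed p hC' ha htC hW₁,
      prob_clusterEvent_eq_massOn_closed p hC' ha htC hW₂,
      prob_clusterEvent_eq_massOn_closed p hC' ha htC hWI,
      prob_clusterEvent_eq_massOn_closed p hC' ha htC hWU]
    have hA := Cactus.massOn_lsm hp hF W₁ W₂
    have hB := tauA_mul (ends := ends) p ha htC hW₁ hW₂
    have hτ0 : ∀ W, 0 ≤ tauA p ends a t W := fun W => tauA_nonneg hp a t W
    calc massOn p ends (within ends C) s W₁ * tauA p ends a t W₁ *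
          (massOn p ends (within ends C) s W₂ * tauA p ends a t W₂)
        = (massOn p ends (within ends C) s W₁ * massOn p ends (within ends C) s W₂) *
          (tauA p ends a t W₁ * tauA p ends a t W₂) := by ring
      _ ≤ (massOn p ends (within ends C) s (W₁ ∩ W₂) * massOn p ends (within ends C) s (W₁ ∪ W₂)) *
          (tauA p ends a t (W₁ ∩ W₂) * tauA p ends a t (W₁ ∪ W₂)) := by
          rw [← hB]
          exact mul_le_mul_of_nonneg_right hA (mul_nonneg (hτ0 _) (hτ0 _))
      _ = _ := by ring
  · -- (κ) the hull factor is constant on the support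
    intro W₁ W₂ hz₁ hz₂
    have hW₁ := hsub W₁ hz₁
    have hW₂ := hsub W₂ hz₂
    have hWI : (↑(W₁ ∩ W₂) : Set V) ⊆ C := by
      rw [Finset.coe_inter]; exact Set.inter_subset_left.trans hW₁
    have hWU : (↑(W₁ ∪ W₂) : Set V) ⊆ C := by
      rw [Finset.coe_union]; exact Set.union_subset hW₁ hW₂
    rw [connDelEvent_eq_of_subset_pendant htC hwC hC hW₁,
      connDelEvent_eq_of_subset_pendant htC hwC hC hW₂,
      connDelEvent_eq_of_subset_pendant htC hwC hC hWI,
      connDelEvent_eq_of_subset_pendant htC hwC hC hWU]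

/-- **THE PENDANT REGION.** The free one-sided gate holds whenever the root's region is closed at
a single vertex `a` separating `t` from `w` and `G[C]` is a triangular cactus built from the root
(Theorem 3 of the paper, single bounding vertex). -/
theorem gateRow_of_pendant_region {p : E → R} (hp : IsProbVec p) (s t a' b u w : V)
    {C : Set V} {a : V} (hs : s ∈ C) (ha : a ∉ C) (htC : t ∉ C) (hwC : w ∉ C)
    (hsep : t ∉ side ends a w)
    (hC : ∀ e, ∀ x ∈ ends e, x ∈ C → ∀ y ∈ ends e, y ∈ C ∨ y = a)
    (hF : IsCactusFrom ends s (within ends C)) :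
    Gate.GateRow p ends s {t} a' b {u} {w} :=
  GateSep.gateRow_of_massBLogSupermod hp s t a' b u w
    (massBLogSupermod_of_pendant_region hp hs ha htC hwC hsep hC hF)

end CactusGate

end Summit.Ventures.PercRepro2
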